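import Summits.HubbardSuperconductivity.HubbardSuperconductivity.Theorems.WidthHaldaneTubeGauge

/-!
# The column step gauge of the Hubbard tube: a pure gauge is a twist at a cut minus a twist at the seam

Support file for the cruxes stated over `WidthHaldaneDefs` (routes `WidthHaldane`, `SeamInduction`;
items stmt-HubbardSuperconductivity-16311/16312/18509/18510), companion of `WidthHaldaneTubeGauge`.
For a cut column `k ≠ 0` of a tube of length `L ≥ 3`, the COLUMN STEP GAUGE is `g_z = e^{iθ'}` on
the columns `z₁ ∈ {k, …, L-1}` (representatives) and `1` on `{0, …, k-1}`. Conjugating the hopping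
`c†_{xσ} c_{yσ}` by `W_g = phaseGauge g` multiplies it by `g_x conj g_y`, which differs from `1`
exactly on the `M` bonds of the cut `(k-1 | k)` (factor `e^{± iθ'}`) and on the `M` seam bonds
`(-1 | 0)` (factor `e^{∓ iθ'}`): a pure gauge inserts a `+θ'` twist at the cut and a `-θ'` twist
at the seam and carries no net flux (Byers–Yang; Watanabe 2019 §2.2.3). Everything is PROVED; no
definitions, no named facts:

* `sum_cols_eq_sum_sum`, `sum_cols_eq_sum_sum'` — a column-pair sum `Σ_b F(e⁻¹(c,b), e⁻¹(c',b))`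
  as a guarded double sum over ordered pairs of sites (generalises `sum_seam_eq_sum_sum`);
* `val_sub_one_add_one` — representatives across a cut;
* `stepGauge_pointwise` — the pointwise identity of coefficients, by cases on the position of the
  ordered pair relative to the cut and to the seam.

The energy-level consequences (gauge additivity of twists, relocation of the twist to any cut,
`2π`-periodicity, cancellation of two `π`-flips) are in `WidthHaldaneTubeTwoCut`.

References: N. Byers, C. N. Yang, PRL 7 (1961) 46; H. Watanabe, J. Stat. Phys. 177 (2019) 717,
§2.2.3, §4.1.
-/

noncomputable section

namespace Summit.HubbardSuperconductivity.HubbardSuperconductivity.Theorems.WidthHaldane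

set_option linter.dupNamespace false -- summit = problem name (single-conjunct summit), D-0017

open scoped BigOperators Classical Matrix ComplexConjugate
open Matrix Literature.MathematicalPhysics.QuantumLattice

section TwoCut

variable (L M : ℕ) [NeZero L] [NeZero M] (Λ : Type) [LinearOrder Λ] [Fintype Λ]
  (e : Λ ≃ ZMod L × ZMod M)

/-- Re-indexing a column pair: `Σ_b F(e⁻¹(c,b), e⁻¹(c',b)) = Σ_{x,y} [x₁ = c ∧ y = e⁻¹(c', x₂)] F(x,y)`.
[folklore] -/
theorem sum_cols_eq_sum_sum {β : Type*} [AddCommMonoid β] (c c' : ZMod L) (F : Λ → Λ → β) :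
    ∑ b : ZMod M, F (e.symm (c, b)) (e.symm (c', b)) =
      ∑ x : Λ, ∑ y : Λ, if (e x).1 = c ∧ y = e.symm (c', (e x).2) then F x y else 0 := by
  have h1 : ∀ x : Λ, (∑ y : Λ, if (e x).1 = c ∧ y = e.symm (c', (e x).2) then F x y else 0) =
      if (e x).1 = c then F x (e.symm (c', (e x).2)) else 0 := by
    intro x
    by_cases hx : (e x).1 = c
    · simp only [hx, true_and, if_true]
      rw [Finset.sum_ite_eq' Finset.univ (e.symm (c', (e x).2)) (fun y => F x y),
        if_pos (Finset.mem_univ _)]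
    · simp [hx]
  simp only [h1]
  rw [← e.symm.sum_comp, Fintype.sum_prod_type, Finset.sum_comm]
  simp only [Equiv.apply_symm_apply, Finset.sum_ite_eq', Finset.mem_univ, if_true]

/-- The reversed column pair, re-indexed. [folklore] -/
theorem sum_cols_eq_sum_sum' {β : Type*} [AddCommMonoid β] (c c' : ZMod L) (F : Λ → Λ → β) :
    ∑ b : ZMod M, F (e.symm (c', b)) (e.symm (c, b)) =
      ∑ x : Λ, ∑ y : Λ, if (e y).1 = c ∧ x = e.symm (c', (e y).2) then F x y else 0 := by
  have h := sum_cols_eq_sum_sum L M Λ e c c' (fun y x => F x y)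
  rw [h, Finset.sum_comm]

omit [NeZero L] [NeZero M] in
/-- Representatives across a cut: if `k ≠ 0` then `(k - 1).val + 1 = k.val` (`L ≥ 2`). [folklore] -/
theorem val_sub_one_add_one (hL : 2 ≤ L) {k : ZMod L} (hk : k ≠ 0) : (k - 1).val + 1 = k.val := by
  have hne : k - 1 ≠ -1 := fun h => hk (by linear_combination h)
  have h := zmod_val_add_one_of_ne_neg_one (L := L) hL hne
  rw [sub_add_cancel] at h
  exact h.symm

omit [NeZero M] [Fintype Λ] in
/-- **The pointwise step-gauge identity.** For a cut column `k ≠ 0` of a tube of length `L ≥ 3`,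
conjugating by the COLUMN STEP GAUGE `g_z = e^{iθ'}` on the columns `z₁ ∈ {k, …, L-1}` and `1` on
`{0, …, k-1}` changes the hopping coefficient `-1` of `c†_{xσ}c_{yσ}` by `-(g_x conj g_y - 1)`,
which is exactly a `+θ'` Peierls twist on the `M` bonds of the cut `(k-1 | k)` plus a `-θ'` twist on
the seam `(-1 | 0)`: a pure gauge carries no net flux. [cite: Watanabe2019, §2.2.3 and §4.1] -/
theorem stepGauge_pointwise (hL : 3 ≤ L) {k : ZMod L} (hk : k ≠ 0) (θ' : ℝ) (x y : Λ) :
    -(if (tubeGraph e).Adj x y then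
        ((Circle.exp (θ' * (if k.val ≤ (e x).1.val then 1 else 0)) : ℂ) *
          conj (Circle.exp (θ' * (if k.val ≤ (e y).1.val then 1 else 0)) : ℂ) - 1)
        else 0) =
      (if (e x).1 = k ∧ y = e.symm (k - 1, (e x).2) then (1 - Complex.exp (Complex.I * θ')) else 0) +
      (if (e y).1 = k ∧ x = e.symm (k - 1, (e y).2) then (1 - Complex.exp (-(Complex.I * θ'))) else 0) +
      (if (e x).1 = 0 ∧ y = e.symm (-1, (e x).2) then (1 - Complex.exp (-(Complex.I * θ'))) else 0) +
      (if (e y).1 = 0 ∧ x = e.symm (-1, (e y).2) then (1 - Complex.exp (Complex.I * θ')) else 0) := by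
  haveI : Fact (1 < L) := ⟨by omega⟩
  have hkv : 1 ≤ k.val := by
    rw [Nat.one_le_iff_ne_zero]
    exact fun h => hk ((ZMod.val_eq_zero k).1 h)
  have hkL : k.val < L := ZMod.val_lt k
  have hk1 := val_sub_one_add_one L (by omega) hk
  have hLm1 : ((-1 : ZMod L)).val + 1 = L := (zmod_eq_neg_one_iff_val (-1 : ZMod L)).1 rfl
  have hexp : ∀ (s t : ℝ), ((Circle.exp (θ' * s) : ℂ) * conj (Circle.exp (θ' * t) : ℂ)) =
      Complex.exp (Complex.I * (θ' * (s - t) : ℝ)) := by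
    intro s t
    rw [Circle.coe_exp, Circle.coe_exp, ← Complex.exp_conj, map_mul, Complex.conj_ofReal, Complex.conj_I,
      ← Complex.exp_add]
    congr 1
    push_cast
    ring
  have e1 : Complex.I * ((θ' * (1 - 0) : ℝ) : ℂ) = Complex.I * θ' := by push_cast; ring
  have e2 : Complex.I * ((θ' * (0 - 1) : ℝ) : ℂ) = -(Complex.I * θ') := by push_cast; ring
  -- `k = -1` and `k - 1 = 0` cannot both hold (`L ≥ 3`)
  have hkk : k = -1 → k - 1 = 0 → False := fun E1 E2 =>
    two_ne_zero_zmod L hL (by linear_combination E1 - E2)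
  -- coordinates
  obtain ⟨⟨a, b⟩, rfl⟩ := e.symm.surjective x
  obtain ⟨⟨a', b'⟩, rfl⟩ := e.symm.surjective y
  simp only [Equiv.apply_symm_apply, EmbeddingLike.apply_eq_iff_eq, SimpleGraph.fromRel_adj, tubeGraph,
    ne_eq, Prod.mk.injEq]
  by_cases hs : (k.val ≤ a.val) ↔ (k.val ≤ a'.val)
  · -- same side of the cut: no phase, and no cut/seam indicator can hold
    have hγ : ((Circle.exp (θ' * (if k.val ≤ a.val then 1 else 0)) : ℂ) *
        conj (Circle.exp (θ' * (if k.val ≤ a'.val then 1 else 0)) : ℂ) - 1) = 0 := by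
      by_cases ha : k.val ≤ a.val
      · rw [if_pos ha, if_pos (hs.1 ha), hexp, sub_self, mul_zero, Complex.ofReal_zero, mul_zero,
          Complex.exp_zero, sub_self]
      · rw [if_neg ha, if_neg (fun h => ha (hs.2 h)), hexp, sub_self, mul_zero, Complex.ofReal_zero,
          mul_zero, Complex.exp_zero, sub_self]
    have hc1 : ¬ (a = k ∧ (a' = k - 1 ∧ b' = b)) := by
      rintro ⟨rfl, rfl, -⟩
      have := hs.1 le_rfl
      omega
    have hc2 : ¬ (a' = k ∧ (a = k - 1 ∧ b = b')) := by
      rintro ⟨rfl, rfl, -⟩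
      have := hs.2 le_rfl
      omega
    have hs1 : ¬ (a = 0 ∧ (a' = -1 ∧ b' = b)) := by
      rintro ⟨rfl, rfl, -⟩
      rw [ZMod.val_zero] at hs
      have := hs.2 (by omega)
      omega
    have hs2 : ¬ (a' = 0 ∧ (a = -1 ∧ b = b')) := by
      rintro ⟨rfl, rfl, -⟩
      rw [ZMod.val_zero] at hs
      have := hs.1 (by omega)
      omega
    rw [if_neg hc1, if_neg hc2, if_neg hs1, if_neg hs2]
    by_cases hadj : (¬(a = a' ∧ b = b') ∧ ((a' = a + 1 ∧ b' = b ∨ a' = a ∧ b' = b + 1) ∨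
        (a = a' + 1 ∧ b = b' ∨ a = a' ∧ b = b' + 1)))
    · rw [if_pos hadj, hγ]; ring
    · rw [if_neg hadj]; ring
  · rw [not_iff] at hs
    by_cases ha : k.val ≤ a.val
    · -- `x` above the cut, `y` below: only cut⁺ or seam⁻ can fire, phase `e^{iθ'}`
      have ha' : ¬ k.val ≤ a'.val := fun h => (hs.2 h) ha
      rw [if_pos ha, if_neg ha', hexp, e1]
      have hs1 : ¬ (a = 0 ∧ (a' = -1 ∧ b' = b)) := by
        rintro ⟨rfl, -, -⟩
        rw [ZMod.val_zero] at ha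
        omega
      have hc2 : ¬ (a' = k ∧ (a = k - 1 ∧ b = b')) := by
        rintro ⟨rfl, -, -⟩
        exact ha' le_rfl
      rw [if_neg hs1, if_neg hc2, add_zero, add_zero]
      by_cases hadj : (¬(a = a' ∧ b = b') ∧ ((a' = a + 1 ∧ b' = b ∨ a' = a ∧ b' = b + 1) ∨
          (a = a' + 1 ∧ b = b' ∨ a = a' ∧ b = b' + 1)))
      · rw [if_pos hadj]
        rcases hadj.2 with (⟨h1, h2⟩ | ⟨h1, -⟩) | (⟨h1, h2⟩ | ⟨h1, -⟩)
        · -- `y = x + e₁`, `y` below, `x` above: the seam, `a = -1`, `a' = 0`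
          have ha1 : a = -1 := by
            by_contra hne
            have hv := zmod_val_add_one_of_ne_neg_one (L := L) (by omega) hne
            rw [← h1] at hv
            omega
          have ha0 : a' = 0 := by rw [h1, ha1, neg_add_cancel]
          have hc1 : ¬ (a = k ∧ (a' = k - 1 ∧ b' = b)) := by
            rintro ⟨hak, hkm, -⟩
            exact hkk (hak ▸ ha1) (hkm ▸ ha0)
          rw [if_neg hc1, zero_add, if_pos (show a' = 0 ∧ (a = -1 ∧ b = b') from ⟨ha0, ha1, h2.symm⟩)]
          ring
        · exact absurd (by rw [h1]; exact ha) ha'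
        · -- `x = y + e₁`: the cut, `a = k`, `a' = k - 1`
          have hne : a' ≠ -1 := by
            rintro rfl
            rw [neg_add_cancel] at h1
            rw [h1, ZMod.val_zero] at ha
            omega
          have hak : a = k := by
            have hv := zmod_val_add_one_of_ne_neg_one (L := L) (by omega) hne
            rw [← h1] at hv
            apply ZMod.val_injective L
            omega
          have hak' : a' = k - 1 := by rw [← hak, h1, add_sub_cancel_right]
          have hs2 : ¬ (a' = 0 ∧ (a = -1 ∧ b = b')) := by
            rintro ⟨h0, hm, -⟩
            exact hkk (hak ▸ hm) (hak' ▸ h0)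
          rw [if_pos (show a = k ∧ (a' = k - 1 ∧ b' = b) from ⟨hak, hak', h2.symm⟩), if_neg hs2, add_zero]
          ring
        · exact absurd (by rw [← h1]; exact ha) ha'
      · rw [if_neg hadj]
        have hc1 : ¬ (a = k ∧ (a' = k - 1 ∧ b' = b)) := by
          rintro ⟨hak, hak', hbb⟩
          refine hadj ⟨fun h => ?_, Or.inr (Or.inl ⟨by rw [hak, hak', sub_add_cancel], hbb.symm⟩)⟩
          have := congrArg ZMod.val h.1
          rw [hak, hak'] at this
          omega
        have hs2 : ¬ (a' = 0 ∧ (a = -1 ∧ b = b')) := by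
          rintro ⟨h0, hm, hbb⟩
          refine hadj ⟨fun h => ?_, Or.inl (Or.inl ⟨by rw [h0, hm, neg_add_cancel], hbb.symm⟩)⟩
          have := congrArg ZMod.val h.1
          rw [hm, h0, ZMod.val_zero] at this
          omega
        rw [if_neg hc1, if_neg hs2, neg_zero, add_zero]
    · -- `x` below the cut, `y` above: only cut⁻ or seam⁺ can fire, phase `e^{-iθ'}`
      have ha' : k.val ≤ a'.val := hs.1 ha
      rw [if_neg ha, if_pos ha', hexp, e2]
      have hc1 : ¬ (a = k ∧ (a' = k - 1 ∧ b' = b)) := by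
        rintro ⟨rfl, -, -⟩
        exact ha le_rfl
      have hs2 : ¬ (a' = 0 ∧ (a = -1 ∧ b = b')) := by
        rintro ⟨rfl, -, -⟩
        rw [ZMod.val_zero] at ha'
        omega
      rw [if_neg hc1, if_neg hs2, zero_add, add_zero]
      by_cases hadj : (¬(a = a' ∧ b = b') ∧ ((a' = a + 1 ∧ b' = b ∨ a' = a ∧ b' = b + 1) ∨
          (a = a' + 1 ∧ b = b' ∨ a = a' ∧ b = b' + 1)))
      · rw [if_pos hadj]
        rcases hadj.2 with (⟨h1, h2⟩ | ⟨h1, -⟩) | (⟨h1, h2⟩ | ⟨h1, -⟩)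
        · -- `y = x + e₁`, `x` below, `y` above: the cut, `a' = k`, `a = k - 1`
          have hne : a ≠ -1 := by
            rintro rfl
            rw [neg_add_cancel] at h1
            rw [h1, ZMod.val_zero] at ha'
            omega
          have hak' : a' = k := by
            have hv := zmod_val_add_one_of_ne_neg_one (L := L) (by omega) hne
            rw [← h1] at hv
            apply ZMod.val_injective L
            omega
          have hak : a = k - 1 := by rw [← hak', h1, add_sub_cancel_right]
          have hs1 : ¬ (a = 0 ∧ (a' = -1 ∧ b' = b)) := by
            rintro ⟨h0, hm, -⟩
            exact hkk (hak' ▸ hm) (hak ▸ h0)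
          rw [if_pos (show a' = k ∧ (a = k - 1 ∧ b = b') from ⟨hak', hak, h2.symm⟩), if_neg hs1, add_zero]
          ring
        · exact absurd (by rw [← h1]; exact ha') ha
        · -- `x = y + e₁`, `x` below, `y` above: the seam, `a' = -1`, `a = 0`
          have ha1 : a' = -1 := by
            by_contra hne
            have hv := zmod_val_add_one_of_ne_neg_one (L := L) (by omega) hne
            rw [← h1] at hv
            omega
          have ha0 : a = 0 := by rw [h1, ha1, neg_add_cancel]
          have hc2 : ¬ (a' = k ∧ (a = k - 1 ∧ b = b')) := by
            rintro ⟨hak, hkm, -⟩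
            exact hkk (hak ▸ ha1) (hkm ▸ ha0)
          rw [if_neg hc2, zero_add, if_pos (show a = 0 ∧ (a' = -1 ∧ b' = b) from ⟨ha0, ha1, h2.symm⟩)]
          ring
        · exact absurd (by rw [h1]; exact ha') ha
      · rw [if_neg hadj]
        have hc2 : ¬ (a' = k ∧ (a = k - 1 ∧ b = b')) := by
          rintro ⟨hak', hak, hbb⟩
          refine hadj ⟨fun h => ?_, Or.inl (Or.inl ⟨by rw [hak', hak, sub_add_cancel], hbb.symm⟩)⟩
          have := congrArg ZMod.val h.1
          rw [hak, hak'] at this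
          omega
        have hs1 : ¬ (a = 0 ∧ (a' = -1 ∧ b' = b)) := by
          rintro ⟨h0, hm, hbb⟩
          refine hadj ⟨fun h => ?_, Or.inr (Or.inl ⟨by rw [h0, hm, neg_add_cancel], hbb.symm⟩)⟩
          have := congrArg ZMod.val h.1
          rw [h0, hm, ZMod.val_zero] at this
          omega
        rw [if_neg hc2, if_neg hs1, neg_zero, add_zero]

end TwoCut

end Summit.HubbardSuperconductivity.HubbardSuperconductivity.Theorems.WidthHaldane

end
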